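import Summits.Ventures.PercRepro.S1CoreCapSpecSpreadFiveHeavy
import Summits.Ventures.PercRepro.S1CoreCapSpecSpreadFiveLinesP

/-!
# PercRepro — THE INSTANCE `ν = 5` OF THE SPREAD SPEC, PROVED: `FourCapSpecSpread capPaper 5 8` (p1, gen 32)

`proofs/P1-S2-CORANK6.md` §4g. The search `fourcap_spread3.py` (`maxlines = 12`, 79 states) reads `Q*_spread(5) = 8` against the kernel
`Q*(5) = 11` of `S1CoreCapSpecFiveCases`; here it is a theorem. Assembly: at most two lines ⟹ `≤ 5` (`cap_add_cap_le_five_spread`); three or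
more lines ⟹ every line has weight `≤ 4` (`wsum_le_four_of_two_spread`); a simple 4-point line makes every other line a simple 3-point line
(`wsum_eq_three_of_beside_weight_four`) and leaves room for at most four of them (`card_le_five_of_weight_four`: `4 + 4 = 8`, the search's
maximiser — a 4-line beside a disjoint `K₄`); otherwise every line has three points, and a fat point `p` (a one-fat line) collects every
one-fat line (`fat_line_through`), at most two of them (`not_three_through_fat`), the cap sum being `#lines + #lines through p ≤ 5 + 1` or
`4 + 2` (`card_le_five_of_weight_four`, `card_le_four_of_two_fat`); otherwise every line is a simple 3-point line of cap `1` and there are at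
most seven (`card_le_seven_of_three_points_spread_five`). What it buys (§4e): with `fourCapSpecSpread_four` the chain at nullity `5` of the
`(14, 6)` cell reads `1 + 4 + 5 + 6 + 8 = 24`, i.e. `s₄ ≤ ⌊20·24/16⌋ = 30` in the spread case (35 before) — the `s₅ / s₆` spread chains remain.
Axioms: standard.
-/

namespace PercRepro

namespace S1

namespace FourCap

variable {β : Type} [DecidableEq β]

/-- The cap of a 3-point line with at most one fat point is `1 + fat`. -/
theorem capPaper_three_eq_one_add {f : ℕ} (hf : f ≤ 1) : capPaper 3 f = 1 + f := by
  rcases (by omega : f = 0 ∨ f = 1) with rfl | rfl <;> decide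

section Main

variable {w : β → ℕ} {ls : Finset (Finset β)}
  (h1 : ∀ L ∈ ls, ∀ v ∈ L, w v = 1 ∨ w v = 2)
  (h2 : ∀ L ∈ ls, 3 ≤ L.card ∧ wsum w L ≤ 5)
  (h3 : ∀ L ∈ ls, ∀ L' ∈ ls, L ≠ L' → (L ∩ L').card ≤ 1)
  (h7 : ∀ l : List (Finset β), l.Nodup → (∀ L ∈ l, L ∈ ls) → lineRank l ≤ 4 → wsum w (unionL l) ≤ lineRank l + 3)

include h1 h2 h3 h7 in
/-- **Beside a simple line of weight `4` every line of weight `≤ 4` has weight `3`**: a second line of weight `4` gives the two-line list the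
rank bound `4 − |L' ∩ L₁|` against weight `8 − |L' ∩ L₁|` (the points of `L₁` are simple). -/
theorem wsum_eq_three_of_beside_weight_four {L₁ L' : Finset β} (hL₁ : L₁ ∈ ls) (hw4 : wsum w L₁ = 4) (hf : fat w L₁ = 0)
    (hL' : L' ∈ ls) (hne : L' ≠ L₁) (hw' : wsum w L' ≤ 4) : wsum w L' = 3 := by
  have hcw := card_le_wsum w L' (h1 L' hL')
  have hk := (h2 L' hL').1
  by_contra hne3
  have hw4' : wsum w L' = 4 := by omega
  have hint : (L' ∩ L₁).card ≤ 1 := h3 L' hL' L₁ hL₁ hne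
  have hsd : (L' \ L₁).card + (L' ∩ L₁).card = L'.card := Finset.card_sdiff_add_card_inter _ _
  have hr : min L₁.card 2 + min (L' \ L₁).card (2 - min (L' ∩ L₁).card 2) ≤ 4 := by
    have : min L₁.card 2 ≤ 2 := min_le_right _ _
    have : min (L' \ L₁).card (2 - min (L' ∩ L₁).card 2) ≤ 2 - min (L' ∩ L₁).card 2 := min_le_right _ _
    omega
  have hc := two_line_spread h7 hL₁ hL' hne hr
  have hwu : wsum w (L' ∪ L₁) = wsum w L₁ + wsum w (L' \ L₁) := by
    rw [Finset.union_comm]; exact (wsum_union_ge w _ _).symm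
  have hsplit := fat_sdiff_add_fat_inter w L' L₁
  have hmono := fat_mono w (Finset.inter_subset_right : L' ∩ L₁ ⊆ L₁)
  have hwsd := wsum_sdiff_eq w L' L₁ (h1 L' hL')
  have hcf := wsum_eq_card_add_fat w L' (h1 L' hL')
  have : min (L' \ L₁).card (2 - min (L' ∩ L₁).card 2) ≤ 2 - min (L' ∩ L₁).card 2 := min_le_right _ _
  have : min L₁.card 2 = 2 := min_eq_right (by omega)
  have : min (L' ∩ L₁).card 2 = (L' ∩ L₁).card := min_eq_left (by omega)
  omega

end Main

/-- **THE INSTANCE `ν = 5` OF THE SPREAD SPEC, PROVED**: `FourCapSpecSpread capPaper 5 8` — the search's `Q*_spread(5) = 8` (against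
`Q*(5) = 11`). Assembly: at most two lines ⟹ `≤ 5`; three or more lines ⟹ every line has weight `≤ 4`; a simple 4-point line beside
simple 3-point lines ⟹ `4 + 4`; a fat point of degree `d ≤ 2` ⟹ `#lines + d ≤ 6`; all simple 3-point lines ⟹ `≤ 7`. -/
theorem fourCapSpecSpread_five : FourCapSpecSpread capPaper 5 8 := by
  intro β _ w ls h1 h2 h3 h4 _ _ h7
  by_cases hbig : 2 < ls.card
  · -- every line has weight `≤ 4`
    have hw4 : ∀ L ∈ ls, wsum w L ≤ 4 := by
      intro L hL
      obtain ⟨L', hL', hne⟩ := Finset.exists_mem_ne (by omega : 1 < ls.card) L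
      exact wsum_le_four_of_two_spread h1 h2 h3 h7 hL hL' hne
    by_cases hex4 : ∃ L ∈ ls, L.card = 4
    · -- a simple 4-point line: every other line is a simple 3-point line, at most four of them
      obtain ⟨L₁, hL₁, hc4⟩ := hex4
      have hcf₁ := wsum_eq_card_add_fat w L₁ (h1 L₁ hL₁)
      have hw₁ := hw4 L₁ hL₁
      have hwL₁ : wsum w L₁ = 4 := by omega
      have hf₁ : fat w L₁ = 0 := by omega
      have hoth : ∀ L ∈ ls, L ≠ L₁ → L.card = 3 ∧ wsum w L = 3 := by
        intro L hL hne
        have hw3 := wsum_eq_three_of_beside_weight_four h1 h2 h3 h7 hL₁ hwL₁ hf₁ hL hne (hw4 L hL)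
        have := card_le_wsum w L (h1 L hL)
        have := (h2 L hL).1
        exact ⟨by omega, hw3⟩
      have hm := card_le_five_of_weight_four h1 h2 h3 h4 h7 hL₁ hwL₁ hoth
      have hothers : ∀ L ∈ ls.erase L₁, capPaper L.card (fat w L) = 1 := by
        intro L hL
        rw [Finset.mem_erase] at hL
        obtain ⟨hc, hw⟩ := hoth L hL.2 hL.1
        have hcf := wsum_eq_card_add_fat w L (h1 L hL.2)
        have hf0 : fat w L = 0 := by omega
        rw [hc, hf0]
        decide
      rw [← Finset.add_sum_erase ls _ hL₁, Finset.sum_congr rfl hothers, Finset.sum_const_nat (fun _ _ => rfl),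
        Finset.card_erase_of_mem hL₁, hc4, hf₁]
      have : capPaper 4 0 = 4 := by decide
      omega
    · push Not at hex4
      -- every line has three points and at most one fat point
      have hc3 : ∀ L ∈ ls, L.card = 3 := by
        intro L hL
        have := card_le_wsum w L (h1 L hL)
        have := (h2 L hL).1
        have := hw4 L hL
        have := hex4 L hL
        omega
      have hf1 : ∀ L ∈ ls, fat w L ≤ 1 := by
        intro L hL
        have := wsum_eq_card_add_fat w L (h1 L hL)
        have := hw4 L hL
        have := hc3 L hL
        omega
      have hsum : ∑ L ∈ ls, capPaper L.card (fat w L) = ls.card + ∑ L ∈ ls, fat w L := by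
        rw [Finset.card_eq_sum_ones, ← Finset.sum_add_distrib]
        exact Finset.sum_congr rfl (fun L hL => by rw [hc3 L hL]; exact capPaper_three_eq_one_add (hf1 L hL))
      by_cases hfat : ∃ F ∈ ls, fat w F = 1
      · -- a fat point `p`
        obtain ⟨F, hF, hfF⟩ := hfat
        obtain ⟨p, hp⟩ := Finset.card_eq_one.1 hfF
        have hpF : p ∈ F ∧ w p = 2 := Finset.mem_filter.1 (hp ▸ Finset.mem_singleton_self p)
        have hwF : wsum w F = 4 := by
          have := wsum_eq_card_add_fat w F (h1 F hF); have := hc3 F hF; omega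
        -- the lines through `p` are the one-fat lines
        have hthrough : ∀ L ∈ ls, fat w L = if p ∈ L then 1 else 0 := by
          intro L hL
          by_cases hpL : p ∈ L
          · rw [if_pos hpL]
            have : 1 ≤ fat w L := by
              unfold fat
              exact Finset.card_pos.2 ⟨p, Finset.mem_filter.2 ⟨hpL, hpF.2⟩⟩
            have := hf1 L hL
            omega
          · rw [if_neg hpL]
            by_contra hne
            have hfL : fat w L = 1 := by have := hf1 L hL; omega
            have hwL : wsum w L = 4 := by
              have := wsum_eq_card_add_fat w L (h1 L hL); have := hc3 L hL; omega
            have hLF : L ≠ F := fun h => hpL (h ▸ hpF.1)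
            exact hpL (fat_line_through h1 h3 h7 hF hL hLF (hc3 F hF) hwF hpF.1 hpF.2 (hc3 L hL) hwL)
        have hsumfat : ∑ L ∈ ls, fat w L = (ls.filter (fun L => p ∈ L)).card := by
          rw [Finset.card_filter]
          exact Finset.sum_congr rfl hthrough
        set P := ls.filter (fun L => p ∈ L) with hP
        have hFP : F ∈ P := Finset.mem_filter.2 ⟨hF, hpF.1⟩
        have hP2 : P.card ≤ 2 := by
          by_contra hlt
          push Not at hlt
          obtain ⟨F₁, F₂, F₃, hF₁, hF₂, hF₃, h12, h13, h23⟩ := Finset.two_lt_card_iff.1 hlt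
          simp only [hP, Finset.mem_filter] at hF₁ hF₂ hF₃
          have hw₁ : wsum w F₁ = 4 := by
            have := wsum_eq_card_add_fat w F₁ (h1 F₁ hF₁.1); have := hc3 F₁ hF₁.1; have := hthrough F₁ hF₁.1
            rw [if_pos hF₁.2] at this; omega
          have hw₂ : wsum w F₂ = 4 := by
            have := wsum_eq_card_add_fat w F₂ (h1 F₂ hF₂.1); have := hc3 F₂ hF₂.1; have := hthrough F₂ hF₂.1
            rw [if_pos hF₂.2] at this; omega
          have hw₃ : wsum w F₃ = 4 := by
            have := wsum_eq_card_add_fat w F₃ (h1 F₃ hF₃.1); have := hc3 F₃ hF₃.1; have := hthrough F₃ hF₃.1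
            rw [if_pos hF₃.2] at this; omega
          exact not_three_through_fat h1 h3 h7 hF₁.1 hF₂.1 hF₃.1 h12.symm h13.symm h23.symm (hc3 F₁ hF₁.1)
            (hc3 F₂ hF₂.1) (hc3 F₃ hF₃.1) hw₁ hw₂ hw₃ hF₁.2 hF₂.2 hF₃.2 hpF.2
        have hP1 : 1 ≤ P.card := Finset.card_pos.2 ⟨F, hFP⟩
        -- a line avoiding `p` is a simple 3-point line
        have hsimple : ∀ L ∈ ls, p ∉ L → L.card = 3 ∧ wsum w L = 3 := by
          intro L hL hpL
          have := hthrough L hL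
          rw [if_neg hpL] at this
          have := wsum_eq_card_add_fat w L (h1 L hL)
          have := hc3 L hL
          exact ⟨hc3 L hL, by omega⟩
        rw [hsum, hsumfat]
        rcases (by omega : P.card = 1 ∨ P.card = 2) with hd1 | hd2
        · -- one one-fat line: `card_le_five_of_weight_four`
          have hPeq : P = {F} := by
            rw [Finset.card_eq_one] at hd1
            obtain ⟨G, hG⟩ := hd1
            rw [hG] at hFP
            rw [Finset.mem_singleton] at hFP
            rw [hG, hFP]
          have hoth : ∀ L ∈ ls, L ≠ F → L.card = 3 ∧ wsum w L = 3 := by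
            intro L hL hne
            refine hsimple L hL (fun hpL => hne ?_)
            have : L ∈ P := Finset.mem_filter.2 ⟨hL, hpL⟩
            rw [hPeq, Finset.mem_singleton] at this
            exact this
          have := card_le_five_of_weight_four h1 h2 h3 h4 h7 hF hwF hoth
          omega
        · -- two one-fat lines through `p`: `card_le_four_of_two_fat`
          obtain ⟨F₁, F₂, hne, hPeq⟩ := Finset.card_eq_two.1 hd2
          have hF₁ : F₁ ∈ ls ∧ p ∈ F₁ := Finset.mem_filter.1 (hPeq ▸ (by simp : F₁ ∈ ({F₁, F₂} : Finset (Finset β))))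
          have hF₂ : F₂ ∈ ls ∧ p ∈ F₂ := Finset.mem_filter.1 (hPeq ▸ (by simp : F₂ ∈ ({F₁, F₂} : Finset (Finset β))))
          have hw₁ : wsum w F₁ = 4 := by
            have := wsum_eq_card_add_fat w F₁ (h1 F₁ hF₁.1); have := hc3 F₁ hF₁.1; have := hthrough F₁ hF₁.1
            rw [if_pos hF₁.2] at this; omega
          have hw₂ : wsum w F₂ = 4 := by
            have := wsum_eq_card_add_fat w F₂ (h1 F₂ hF₂.1); have := hc3 F₂ hF₂.1; have := hthrough F₂ hF₂.1
            rw [if_pos hF₂.2] at this; omega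
          have hoth : ∀ L ∈ ls, L ≠ F₁ → L ≠ F₂ → L.card = 3 ∧ wsum w L = 3 := by
            intro L hL hne1 hne2
            refine hsimple L hL (fun hpL => ?_)
            have : L ∈ P := Finset.mem_filter.2 ⟨hL, hpL⟩
            rw [hPeq, Finset.mem_insert, Finset.mem_singleton] at this
            rcases this with h | h
            · exact hne1 h
            · exact hne2 h
          have := card_le_four_of_two_fat h1 h2 h3 h4 h7 hF₁.1 hF₂.1 hne.symm (hc3 F₁ hF₁.1) (hc3 F₂ hF₂.1) hw₁ hw₂
            hF₁.2 hF₂.2 hpF.2 hoth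
          omega
      · -- every line is a simple 3-point line: at most seven
        push Not at hfat
        have hf0 : ∀ L ∈ ls, fat w L = 0 := by
          intro L hL
          have := hf1 L hL
          have := hfat L hL
          omega
        have hw1 : ∀ L ∈ ls, ∀ v ∈ L, w v = 1 := by
          intro L hL v hv
          rcases h1 L hL v hv with h | h
          · exact h
          · exfalso
            have : 0 < fat w L := by
              unfold fat
              exact Finset.card_pos.2 ⟨v, Finset.mem_filter.2 ⟨hv, h⟩⟩
            have := hf0 L hL
            omega
        have hm := card_le_seven_of_three_points_spread_five hw1 hc3 h3 h4 h7
        rw [hsum, Finset.sum_congr rfl hf0, Finset.sum_const_nat (fun _ _ => rfl)]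
        omega
  · push Not at hbig
    rcases (by omega : ls.card = 0 ∨ ls.card = 1 ∨ ls.card = 2) with h0 | hone | htwo
    · rw [Finset.card_eq_zero.1 h0]
      simp
    · obtain ⟨L, rfl⟩ := Finset.card_eq_one.1 hone
      rw [Finset.sum_singleton]
      have hk := h2 L (Finset.mem_singleton_self L)
      have hcf := wsum_eq_card_add_fat w L (h1 L (Finset.mem_singleton_self L))
      exact (capPaper_le_five hk.1 (by omega)).trans (by omega)
    · obtain ⟨L, L', hne, rfl⟩ := Finset.card_eq_two.1 htwo
      rw [Finset.sum_pair hne]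
      exact (cap_add_cap_le_five_spread h1 h2 h3 h7 (by simp) (by simp) hne.symm).trans (by omega)

end FourCap

end S1

end PercRepro
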